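import Mathlib
import HarnessLib
import Literature.NumberTheory.LFunctions.VanDerCorputZeta

/-!
# Robert–Sargos 2002, Step 4 ingredients: Taylor remainders and mixed differences — PROVED

Topic `Literature/NumberTheory/LFunctions`. Everything here is PROVED (no `sorry`, no named facts).
This file supplies the calculus of Step 4 ((4·13)–(4·16)) of the proof of Theorem 1 of O. Robert,
P. Sargos, *A fourth derivative test for exponential sums*, Compositio Math. 130 (2002) 275–292
(= arXiv:2307.03562v1), for a phase given by a derivative family `D` of order `4`
(`Literature.NumberTheory.LFunctions.VdC.DerivFamily`, `D 0 = f`, …, `D 4 = f⁗`) with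
`|D 4| ≤ Λ` on `[a, b]`:

* the Taylor remainders `v_m` of `f` at `m` ((4·13)): `tV D m j y` is the remainder of order `3 - j`
  of `D j` at `m`, so `f(m+y) = f(m) + y f'(m) + (y²/2) f''(m) + (y³/6) f'''(m) + tV D m 0 y`, with
  `(tV D m j)' = tV D m (j+1)` and `|tV D m j y| ≤ Λ |y|^{4-j}` (crude constants);
* the perturbation `u_{m,r}(q,h,n) = v_m(n+q+h) - v_m(n+q-h) - v_m(n+h+r) + v_m(n-h-r)` ((4·14)) and
  the identity (4·16)
  `Δ_h f(m+n+q) - Δ_{h+r} f(m+n) = -2r f'(m) + x_m P₁ + y_m P₂ - (r³/3) f'''(m) + u_{m,r}(q,h,n)`,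
  `x_m = 2f''(m)`, `y_m = f'''(m)`, `P₁ = hq - rn`, `P₂ = hq² + 2hqn - rn² - rh² - r²h` ((4·12));
* bounds for the seven mixed unit differences of `u_{m,r}` in `(q, h, n)` (the input (2·3) of the
  partial summation, Lemma 2): first order `≤ 4ΛY³`, second order `≤ 4ΛY²`, third order `≤ 2ΛY`,
  when all arguments lie in `[-(Y-3), Y-3]` and `[m-Y, m+Y] ⊆ [a, b]`;
* the increment facts used in Steps 5–6: `|f'''(m) - f'''(m')| ≤ Λ|m - m'|`, and for `λ ≤ D 4 ≤ Λ`: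
  `λ(y-x) ≤ f'''(y) - f'''(x) ≤ Λ(y-x)` and
  `2kλ(y-x) ≤ (2f''(y+k) - 2f''(y)) - (2f''(x+k) - 2f''(x)) ≤ 2kΛ(y-x)`.

## References

* O. Robert, P. Sargos, *A fourth derivative test for exponential sums*, Compositio Math. 130 (2002),
  275–292, doi:10.1023/A:1014363224308 = arXiv:2307.03562v1 — §4, Step 4, (4·12)–(4·16). [RobertSargos2002]
-/

noncomputable section

open Set

namespace Literature.NumberTheory.LFunctions
namespace RobertSargos

open Literature.NumberTheory.LFunctions.VdC (DerivFamily)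

/-! ### Mean value helpers -/

/-- `|w(y) - w(x)| ≤ B (y - x)` when `|w'| ≤ B` on `[x, y]`. [folklore] -/
theorem abs_sub_le_of_hasDerivAt {w w' : ℝ → ℝ} {x y B : ℝ} (hxy : x ≤ y)
    (hw : ∀ t ∈ Icc x y, HasDerivAt w (w' t) t) (hB : ∀ t ∈ Icc x y, |w' t| ≤ B) :
    |w y - w x| ≤ B * (y - x) := by
  rcases eq_or_lt_of_le hxy with h | h
  · subst h; simp
  obtain ⟨ξ, hξ, hξ'⟩ := exists_hasDerivAt_eq_slope w w' h
    (fun t ht => (hw t ht).continuousAt.continuousWithinAt)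
    (fun t ht => hw t (Ioo_subset_Icc_self ht))
  have hB' := hB ξ (Ioo_subset_Icc_self hξ)
  have : w y - w x = w' ξ * (y - x) := by rw [hξ']; field_simp
  rw [this, abs_mul, abs_of_pos (by linarith : (0:ℝ) < y - x)]
  exact mul_le_mul_of_nonneg_right hB' (by linarith)

/-- `m (y - x) ≤ w(y) - w(x) ≤ M (y - x)` when `m ≤ w' ≤ M` on `[x, y]`. [folklore] -/
theorem sub_mem_of_hasDerivAt {w w' : ℝ → ℝ} {x y m M : ℝ} (hxy : x ≤ y)
    (hw : ∀ t ∈ Icc x y, HasDerivAt w (w' t) t) (hmM : ∀ t ∈ Icc x y, m ≤ w' t ∧ w' t ≤ M) :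
    m * (y - x) ≤ w y - w x ∧ w y - w x ≤ M * (y - x) := by
  rcases eq_or_lt_of_le hxy with h | h
  · subst h; simp
  obtain ⟨ξ, hξ, hξ'⟩ := exists_hasDerivAt_eq_slope w w' h
    (fun t ht => (hw t ht).continuousAt.continuousWithinAt)
    (fun t ht => hw t (Ioo_subset_Icc_self ht))
  have hB' := hmM ξ (Ioo_subset_Icc_self hξ)
  have : w y - w x = w' ξ * (y - x) := by rw [hξ']; field_simp
  rw [this]
  constructor <;> nlinarith [hB'.1, hB'.2]

/-- The unit forward difference. [folklore] -/
def fd (F : ℝ → ℝ) (y : ℝ) : ℝ := F (y + 1) - F y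

/-- `fd` of a differentiable function is differentiable with derivative `fd` of the derivative.
[folklore] -/
theorem hasDerivAt_fd {F F' : ℝ → ℝ} {y : ℝ} (h0 : HasDerivAt F (F' y) y)
    (h1 : HasDerivAt F (F' (y + 1)) (y + 1)) : HasDerivAt (fd F) (fd F' y) y := by
  unfold fd
  exact (HasDerivAt.comp_add_const y 1 h1).sub h0

/-- `|fd F y| ≤ B` when `|F'| ≤ B` on `[y, y+1]`. [folklore] -/
theorem abs_fd_le {F F' : ℝ → ℝ} {y B : ℝ} (hF : ∀ t ∈ Icc y (y + 1), HasDerivAt F (F' t) t)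
    (hB : ∀ t ∈ Icc y (y + 1), |F' t| ≤ B) : |fd F y| ≤ B := by
  have := abs_sub_le_of_hasDerivAt (by linarith) hF hB
  simpa [fd] using this

/-- Second differences: `|fd (fd F) y| ≤ B` when `|F''| ≤ B` on `[y, y+2]`. [folklore] -/
theorem abs_fd_fd_le {F F' F'' : ℝ → ℝ} {y B : ℝ} (hF : ∀ t ∈ Icc y (y + 2), HasDerivAt F (F' t) t)
    (hF' : ∀ t ∈ Icc y (y + 2), HasDerivAt F' (F'' t) t) (hB : ∀ t ∈ Icc y (y + 2), |F'' t| ≤ B) :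
    |fd (fd F) y| ≤ B := by
  refine abs_fd_le (F' := fd F') (fun t ht => hasDerivAt_fd (hF t ⟨ht.1, by linarith [ht.2]⟩)
    (hF (t + 1) ⟨by linarith [ht.1], by linarith [ht.2]⟩)) fun t ht => ?_
  exact abs_fd_le (fun s hs => hF' s ⟨by linarith [hs.1, ht.1], by linarith [hs.2, ht.2]⟩)
    fun s hs => hB s ⟨by linarith [hs.1, ht.1], by linarith [hs.2, ht.2]⟩

/-- Third differences: `|fd (fd (fd F)) y| ≤ B` when `|F'''| ≤ B` on `[y, y+3]`. [folklore] -/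
theorem abs_fd_fd_fd_le {F F' F'' F''' : ℝ → ℝ} {y B : ℝ}
    (hF : ∀ t ∈ Icc y (y + 3), HasDerivAt F (F' t) t)
    (hF' : ∀ t ∈ Icc y (y + 3), HasDerivAt F' (F'' t) t)
    (hF'' : ∀ t ∈ Icc y (y + 3), HasDerivAt F'' (F''' t) t)
    (hB : ∀ t ∈ Icc y (y + 3), |F''' t| ≤ B) : |fd (fd (fd F)) y| ≤ B := by
  refine abs_fd_le (F' := fd (fd F')) (fun t ht => ?_) fun t ht => ?_
  · exact hasDerivAt_fd (hasDerivAt_fd (hF t ⟨ht.1, by linarith [ht.2]⟩)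
      (hF (t + 1) ⟨by linarith [ht.1], by linarith [ht.2]⟩))
      (hasDerivAt_fd (hF (t + 1) ⟨by linarith [ht.1], by linarith [ht.2]⟩)
      (by have := hF (t + 1 + 1) ⟨by linarith [ht.1], by linarith [ht.2]⟩; exact this))
  · exact abs_fd_fd_le (fun s hs => hF' s ⟨by linarith [hs.1, ht.1], by linarith [hs.2, ht.2]⟩)
      (fun s hs => hF'' s ⟨by linarith [hs.1, ht.1], by linarith [hs.2, ht.2]⟩)
      fun s hs => hB s ⟨by linarith [hs.1, ht.1], by linarith [hs.2, ht.2]⟩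

/-! ### Taylor remainders of a derivative family ((4·13)) -/

/-- `tV D m j y`: the Taylor remainder of order `3 - j` of `D j` at `m`, evaluated at `m + y`
(`j = 0,1,2,3`; for `j ≥ 4` just `D j (m + y)`). [cite: RobertSargos2002, (4.13)] -/
def tV (D : ℕ → ℝ → ℝ) (m : ℝ) : ℕ → ℝ → ℝ
  | 0, y => D 0 (m + y) - D 0 m - y * D 1 m - y ^ 2 / 2 * D 2 m - y ^ 3 / 6 * D 3 m
  | 1, y => D 1 (m + y) - D 1 m - y * D 2 m - y ^ 2 / 2 * D 3 m
  | 2, y => D 2 (m + y) - D 2 m - y * D 3 m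
  | 3, y => D 3 (m + y) - D 3 m
  | (j + 4), y => D (j + 4) (m + y)

/-- `(tV D m j)' = tV D m (j+1)` for `j ≤ 3`, wherever `m + y ∈ [a, b]`. [folklore] -/
theorem hasDerivAt_tV {D : ℕ → ℝ → ℝ} {a b : ℝ} (hD : DerivFamily D a b 4) (m : ℝ) {j : ℕ}
    (hj : j ≤ 3) {y : ℝ} (hy : m + y ∈ Icc a b) : HasDerivAt (tV D m j) (tV D m (j + 1) y) y := by
  have hc : ∀ i, i < 4 → HasDerivAt (fun y => D i (m + y)) (D (i + 1) (m + y)) y :=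
    fun i hi => HasDerivAt.comp_const_add m y (hD i hi (m + y) hy)
  have hid : HasDerivAt (fun y : ℝ => y) 1 y := hasDerivAt_id' y
  have hsq : HasDerivAt (fun y : ℝ => y ^ 2 / 2) y y := by
    have := (hasDerivAt_pow 2 y).div_const 2
    refine this.congr_deriv ?_
    simp
  have hcu : HasDerivAt (fun y : ℝ => y ^ 3 / 6) (y ^ 2 / 2) y := by
    have := (hasDerivAt_pow 3 y).div_const 6
    refine this.congr_deriv ?_
    push_cast; ring
  interval_cases j
  · exact (((((hc 0 (by norm_num)).sub_const (D 0 m)).sub (hid.mul_const (D 1 m))).sub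
      (hsq.mul_const (D 2 m))).sub (hcu.mul_const (D 3 m))).congr_deriv (by simp [tV])
  · exact ((((hc 1 (by norm_num)).sub_const (D 1 m)).sub (hid.mul_const (D 2 m))).sub
      (hsq.mul_const (D 3 m))).congr_deriv (by simp [tV])
  · exact (((hc 2 (by norm_num)).sub_const (D 2 m)).sub (hid.mul_const (D 3 m))).congr_deriv (by simp [tV])
  · exact ((hc 3 (by norm_num)).sub_const (D 3 m)).congr_deriv (by simp [tV])

/-- `|tV D m 3 y| ≤ Λ|y|` when `|D 4| ≤ Λ` on `[a,b] ∋ m, m+y`. [folklore] -/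
theorem abs_tV_three_le {D : ℕ → ℝ → ℝ} {a b Λ : ℝ} (hD : DerivFamily D a b 4)
    (hΛ : ∀ t ∈ Icc a b, |D 4 t| ≤ Λ) {m y : ℝ} (hm : m ∈ Icc a b) (hy : m + y ∈ Icc a b) :
    |tV D m 3 y| ≤ Λ * |y| := by
  show |D 3 (m + y) - D 3 m| ≤ Λ * |y|
  have h3 := fun t (ht : t ∈ Icc a b) => hD 3 (by norm_num) t ht
  rcases le_total 0 y with h0 | h0
  · have hsub : Icc m (m + y) ⊆ Icc a b := Icc_subset_Icc hm.1 hy.2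
    have := abs_sub_le_of_hasDerivAt (by linarith) (fun t ht => h3 t (hsub ht)) fun t ht => hΛ t (hsub ht)
    rw [abs_of_nonneg h0]; convert this using 2; ring
  · have hsub : Icc (m + y) m ⊆ Icc a b := Icc_subset_Icc hy.1 hm.2
    have := abs_sub_le_of_hasDerivAt (by linarith) (fun t ht => h3 t (hsub ht)) fun t ht => hΛ t (hsub ht)
    rw [abs_of_nonpos h0, abs_sub_comm]; convert this using 2; ring

/-- Bounds for all the Taylor remainders on a ball: if `[m - Y, m + Y] ⊆ [a, b]` and `|D 4| ≤ Λ`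
on `[a, b]`, then for `|y| ≤ Y`: `|tV D m 3 y| ≤ ΛY`, `|tV D m 2 y| ≤ ΛY²`, `|tV D m 1 y| ≤ ΛY³`,
`|tV D m 0 y| ≤ ΛY⁴`. [cite: RobertSargos2002, (4.13)] -/
theorem abs_tV_le {D : ℕ → ℝ → ℝ} {a b Λ : ℝ} (hD : DerivFamily D a b 4)
    (hΛ : ∀ t ∈ Icc a b, |D 4 t| ≤ Λ) {m Y : ℝ} (hY : 0 ≤ Y) (hmY : Icc (m - Y) (m + Y) ⊆ Icc a b) :
    ∀ y : ℝ, |y| ≤ Y →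
      |tV D m 3 y| ≤ Λ * Y ∧ |tV D m 2 y| ≤ Λ * Y ^ 2 ∧ |tV D m 1 y| ≤ Λ * Y ^ 3 ∧
        |tV D m 0 y| ≤ Λ * Y ^ 4 := by
  have hm : m ∈ Icc a b := hmY ⟨by linarith, by linarith⟩
  have hin : ∀ y : ℝ, |y| ≤ Y → m + y ∈ Icc a b := fun y hy =>
    hmY ⟨by linarith [(abs_le.mp hy).1], by linarith [(abs_le.mp hy).2]⟩
  have hΛ0 : 0 ≤ Λ := le_trans (abs_nonneg _) (hΛ m hm)
  -- order 3
  have h3 : ∀ y : ℝ, |y| ≤ Y → |tV D m 3 y| ≤ Λ * Y := fun y hy =>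
    (abs_tV_three_le hD hΛ hm (hin y hy)).trans (mul_le_mul_of_nonneg_left hy hΛ0)
  -- generic step: from a bound on `tV (j+1)` to one on `tV j` (which vanishes at `0`)
  have step : ∀ j : ℕ, j ≤ 2 → ∀ B : ℝ, (∀ y : ℝ, |y| ≤ Y → |tV D m (j + 1) y| ≤ B) →
      ∀ y : ℝ, |y| ≤ Y → |tV D m j y| ≤ B * Y := by
    intro j hj B hB y hy
    have h0 : tV D m j 0 = 0 := by interval_cases j <;> simp [tV]
    have hder : ∀ t : ℝ, |t| ≤ Y → HasDerivAt (tV D m j) (tV D m (j + 1) t) t :=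
      fun t ht => hasDerivAt_tV hD m (by omega) (hin t ht)
    rcases le_total 0 y with hy0 | hy0
    · have hI : ∀ t ∈ Icc 0 y, |t| ≤ Y := fun t ht => by
        rw [abs_of_nonneg ht.1]; exact ht.2.trans ((le_abs_self y).trans hy)
      have := abs_sub_le_of_hasDerivAt hy0 (fun t ht => hder t (hI t ht)) fun t ht => hB t (hI t ht)
      rw [h0, sub_zero, sub_zero] at this
      exact this.trans (mul_le_mul_of_nonneg_left ((le_abs_self y).trans hy)
        (le_trans (abs_nonneg _) (hB 0 (by simp [hY]))))
    · have hI : ∀ t ∈ Icc y 0, |t| ≤ Y := fun t ht => by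
        rw [abs_of_nonpos ht.2]; have := (abs_le.mp hy).1; linarith [ht.1]
      have := abs_sub_le_of_hasDerivAt hy0 (fun t ht => hder t (hI t ht)) fun t ht => hB t (hI t ht)
      rw [h0, zero_sub, abs_neg, zero_sub] at this
      exact this.trans (mul_le_mul_of_nonneg_left ((neg_le_abs y).trans hy)
        (le_trans (abs_nonneg _) (hB 0 (by simp [hY]))))
  have h2 : ∀ y : ℝ, |y| ≤ Y → |tV D m 2 y| ≤ Λ * Y ^ 2 := fun y hy => by
    have := step 2 (by norm_num) _ h3 y hy; rw [sq, ← mul_assoc]; exact this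
  have h1 : ∀ y : ℝ, |y| ≤ Y → |tV D m 1 y| ≤ Λ * Y ^ 3 := fun y hy => by
    have := step 1 (by norm_num) _ h2 y hy
    calc |tV D m 1 y| ≤ Λ * Y ^ 2 * Y := this
      _ = Λ * Y ^ 3 := by ring
  have h0' : ∀ y : ℝ, |y| ≤ Y → |tV D m 0 y| ≤ Λ * Y ^ 4 := fun y hy => by
    have := step 0 (by norm_num) _ h1 y hy
    calc |tV D m 0 y| ≤ Λ * Y ^ 3 * Y := this
      _ = Λ * Y ^ 4 := by ring
  exact fun y hy => ⟨h3 y hy, h2 y hy, h1 y hy, h0' y hy⟩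

/-! ### Unit differences of the remainder -/

/-- Differences of `v = tV D m 0` of orders `1, 2, 3` on the ball: `|fd v y| ≤ ΛY³`,
`|fd² v y| ≤ ΛY²`, `|fd³ v y| ≤ ΛY`, whenever `|y| + 3 ≤ Y`. [cite: RobertSargos2002, Step 4] -/
theorem abs_fd_tV_le {D : ℕ → ℝ → ℝ} {a b Λ : ℝ} (hD : DerivFamily D a b 4)
    (hΛ : ∀ t ∈ Icc a b, |D 4 t| ≤ Λ) {m Y : ℝ} (hY : 0 ≤ Y) (hmY : Icc (m - Y) (m + Y) ⊆ Icc a b)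
    {y : ℝ} (hy : |y| + 3 ≤ Y) :
    |fd (tV D m 0) y| ≤ Λ * Y ^ 3 ∧ |fd (fd (tV D m 0)) y| ≤ Λ * Y ^ 2 ∧
      |fd (fd (fd (tV D m 0))) y| ≤ Λ * Y := by
  have hin : ∀ t : ℝ, |t| ≤ Y → m + t ∈ Icc a b := fun t ht =>
    hmY ⟨by linarith [(abs_le.mp ht).1], by linarith [(abs_le.mp ht).2]⟩
  have hball : ∀ t ∈ Icc y (y + 3), |t| ≤ Y := fun t ht => by
    rw [abs_le]; have := abs_le.mp (show |y| ≤ Y - 3 by linarith)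
    constructor <;> linarith [ht.1, ht.2, this.1, this.2]
  have hb := abs_tV_le hD hΛ hY hmY
  have hder : ∀ j : ℕ, j ≤ 3 → ∀ t ∈ Icc y (y + 3), HasDerivAt (tV D m j) (tV D m (j + 1) t) t :=
    fun j hj t ht => hasDerivAt_tV hD m hj (hin t (hball t ht))
  refine ⟨?_, ?_, ?_⟩
  · exact abs_fd_le (fun t ht => hder 0 (by norm_num) t ⟨ht.1, by linarith [ht.2]⟩)
      fun t ht => (hb t (hball t ⟨ht.1, by linarith [ht.2]⟩)).2.2.1
  · exact abs_fd_fd_le (fun t ht => hder 0 (by norm_num) t ⟨ht.1, by linarith [ht.2]⟩)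
      (fun t ht => hder 1 (by norm_num) t ⟨ht.1, by linarith [ht.2]⟩)
      fun t ht => (hb t (hball t ⟨ht.1, by linarith [ht.2]⟩)).2.1
  · exact abs_fd_fd_fd_le (fun t ht => hder 0 (by norm_num) t ht) (fun t ht => hder 1 (by norm_num) t ht)
      (fun t ht => hder 2 (by norm_num) t ht) fun t ht => (hb t (hball t ht)).1

/-! ### The perturbation `u_{m,r}` and the identity (4·16) -/

/-- `u_{m,r}(q,h,n) = v_m(n+q+h) - v_m(n+q-h) - v_m(n+h+r) + v_m(n-h-r)` ((4·14)).
[cite: RobertSargos2002, (4.14)] -/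
def uPert (D : ℕ → ℝ → ℝ) (m r q h n : ℝ) : ℝ :=
  tV D m 0 (n + q + h) - tV D m 0 (n + q - h) - tV D m 0 (n + h + r) + tV D m 0 (n - h - r)

/-- `P₁(r,q,h,n) = hq - rn` ((4·12)). [cite: RobertSargos2002, (4.12)] -/
def P₁ (r q h n : ℤ) : ℤ := h * q - r * n

/-- `P₂(r,q,h,n) = hq² + 2hqn - rn² - rh² - r²h` ((4·12)). [cite: RobertSargos2002, (4.12)] -/
def P₂ (r q h n : ℤ) : ℤ := h * q ^ 2 + 2 * h * q * n - r * n ^ 2 - r * h ^ 2 - r ^ 2 * h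

/-- **The identity (4·16)**:
`Δ_h f(m+n+q) - Δ_{h+r} f(m+n) = -2r f'(m) + 2f''(m) P₁ + f'''(m) P₂ - (r³/3) f'''(m) + u_{m,r}(q,h,n)`
where `Δ_h f(x) = f(x+h) - f(x-h)`. [cite: RobertSargos2002, (4.16)] -/
theorem taylor_identity (D : ℕ → ℝ → ℝ) (m : ℝ) (r q h n : ℤ) :
    (D 0 (m + n + q + h) - D 0 (m + n + q - h)) - (D 0 (m + n + h + r) - D 0 (m + n - h - r)) =
      -2 * r * D 1 m + 2 * D 2 m * (P₁ r q h n : ℤ) + D 3 m * (P₂ r q h n : ℤ) - (r : ℝ) ^ 3 / 3 * D 3 m +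
        uPert D m r q h n := by
  simp only [uPert, tV, P₁, P₂]
  push_cast
  have e1 : m + ((n : ℝ) + q + h) = m + n + q + h := by ring
  have e2 : m + ((n : ℝ) + q - h) = m + n + q - h := by ring
  have e3 : m + ((n : ℝ) + h + r) = m + n + h + r := by ring
  have e4 : m + ((n : ℝ) - h - r) = m + n - h - r := by ring
  rw [e1, e2, e3, e4]
  ring

/-! ### Mixed differences of `u_{m,r}` -/

/-- The seven mixed unit differences of `u = u_{m,r}(q,h,n)` in terms of forward differences of
`v = tV D m 0` (pure algebra). [folklore] -/
theorem uPert_differences (D : ℕ → ℝ → ℝ) (m r q h n : ℝ) :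
    (uPert D m r (q + 1) h n - uPert D m r q h n =
        fd (tV D m 0) (n + q + h) - fd (tV D m 0) (n + q - h)) ∧
    (uPert D m r q (h + 1) n - uPert D m r q h n =
        fd (tV D m 0) (n + q + h) + fd (tV D m 0) (n + q - h - 1) -
          fd (tV D m 0) (n + h + r) - fd (tV D m 0) (n - h - r - 1)) ∧
    (uPert D m r q h (n + 1) - uPert D m r q h n =
        fd (tV D m 0) (n + q + h) - fd (tV D m 0) (n + q - h) -
          fd (tV D m 0) (n + h + r) + fd (tV D m 0) (n - h - r)) ∧
    (uPert D m r (q + 1) (h + 1) n - uPert D m r (q + 1) h n - uPert D m r q (h + 1) n + uPert D m r q h n =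
        fd (fd (tV D m 0)) (n + q + h) + fd (fd (tV D m 0)) (n + q - h - 1)) ∧
    (uPert D m r (q + 1) h (n + 1) - uPert D m r q h (n + 1) - uPert D m r (q + 1) h n + uPert D m r q h n =
        fd (fd (tV D m 0)) (n + q + h) - fd (fd (tV D m 0)) (n + q - h)) ∧
    (uPert D m r q (h + 1) (n + 1) - uPert D m r q h (n + 1) - uPert D m r q (h + 1) n + uPert D m r q h n =
        fd (fd (tV D m 0)) (n + q + h) + fd (fd (tV D m 0)) (n + q - h - 1) -
          fd (fd (tV D m 0)) (n + h + r) - fd (fd (tV D m 0)) (n - h - r - 1)) ∧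
    ((uPert D m r (q + 1) (h + 1) (n + 1) - uPert D m r (q + 1) h (n + 1) - uPert D m r q (h + 1) (n + 1) +
          uPert D m r q h (n + 1)) -
        (uPert D m r (q + 1) (h + 1) n - uPert D m r (q + 1) h n - uPert D m r q (h + 1) n + uPert D m r q h n) =
        fd (fd (fd (tV D m 0))) (n + q + h) + fd (fd (fd (tV D m 0))) (n + q - h - 1)) := by
  simp only [uPert, fd]
  refine ⟨?_, ?_, ?_, ?_, ?_, ?_, ?_⟩ <;> ring_nf

/-- **Mixed differences of `u_{m,r}`** (the input (2·3) of Lemma 2 in Step 4): if `|D 4| ≤ Λ` on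
`[a, b] ⊇ [m - Y, m + Y]` and the four arguments `n+q+h, n+q-h, n+h+r, n-h-r` have absolute value
`≤ Y - 4`, then the first-order unit differences of `u_{m,r}` in `q, h, n` are `≤ 4ΛY³`, the second
order ones `≤ 4ΛY²`, and the third order one `≤ 2ΛY`. [cite: RobertSargos2002, Step 4] -/
theorem uPert_diff_bounds {D : ℕ → ℝ → ℝ} {a b Λ : ℝ} (hD : DerivFamily D a b 4)
    (hΛ : ∀ t ∈ Icc a b, |D 4 t| ≤ Λ) {m Y : ℝ} (hY : 0 ≤ Y) (hmY : Icc (m - Y) (m + Y) ⊆ Icc a b)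
    {r q h n : ℝ} (h1 : |n + q + h| ≤ Y - 4) (h2 : |n + q - h| ≤ Y - 4) (h3 : |n + h + r| ≤ Y - 4)
    (h4 : |n - h - r| ≤ Y - 4) :
    |uPert D m r (q + 1) h n - uPert D m r q h n| ≤ 4 * Λ * Y ^ 3 ∧
    |uPert D m r q (h + 1) n - uPert D m r q h n| ≤ 4 * Λ * Y ^ 3 ∧
    |uPert D m r q h (n + 1) - uPert D m r q h n| ≤ 4 * Λ * Y ^ 3 ∧
    |uPert D m r (q + 1) (h + 1) n - uPert D m r (q + 1) h n - uPert D m r q (h + 1) n + uPert D m r q h n| ≤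
      4 * Λ * Y ^ 2 ∧
    |uPert D m r (q + 1) h (n + 1) - uPert D m r q h (n + 1) - uPert D m r (q + 1) h n + uPert D m r q h n| ≤
      4 * Λ * Y ^ 2 ∧
    |uPert D m r q (h + 1) (n + 1) - uPert D m r q h (n + 1) - uPert D m r q (h + 1) n + uPert D m r q h n| ≤
      4 * Λ * Y ^ 2 ∧
    |(uPert D m r (q + 1) (h + 1) (n + 1) - uPert D m r (q + 1) h (n + 1) - uPert D m r q (h + 1) (n + 1) +
          uPert D m r q h (n + 1)) -
        (uPert D m r (q + 1) (h + 1) n - uPert D m r (q + 1) h n - uPert D m r q (h + 1) n + uPert D m r q h n)| ≤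
      2 * Λ * Y := by
  obtain ⟨e1, e2, e3, e12, e13, e23, e123⟩ := uPert_differences D m r q h n
  have hm : m ∈ Icc a b := hmY ⟨by linarith, by linarith⟩
  have hΛ0 : 0 ≤ Λ := le_trans (abs_nonneg _) (hΛ m hm)
  -- bounds at all the needed points (each has `|y| + 3 ≤ Y`)
  have B : ∀ y : ℝ, |y| + 3 ≤ Y → |fd (tV D m 0) y| ≤ Λ * Y ^ 3 ∧ |fd (fd (tV D m 0)) y| ≤ Λ * Y ^ 2 ∧
      |fd (fd (fd (tV D m 0))) y| ≤ Λ * Y := fun y hy => abs_fd_tV_le hD hΛ hY hmY hy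
  have k1 : |n + q + h| + 3 ≤ Y := by linarith
  have k2 : |n + q - h| + 3 ≤ Y := by linarith
  have k2' : |n + q - h - 1| + 3 ≤ Y := by
    have := abs_sub (n + q - h) 1; rw [abs_one] at this; linarith
  have k3 : |n + h + r| + 3 ≤ Y := by linarith
  have k4 : |n - h - r| + 3 ≤ Y := by linarith
  have k4' : |n - h - r - 1| + 3 ≤ Y := by
    have := abs_sub (n - h - r) 1; rw [abs_one] at this; linarith
  have Y3 : 0 ≤ Λ * Y ^ 3 := by positivity
  have Y2 : 0 ≤ Λ * Y ^ 2 := by positivity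
  refine ⟨?_, ?_, ?_, ?_, ?_, ?_, ?_⟩
  · rw [e1]
    calc _ ≤ |fd (tV D m 0) (n + q + h)| + |fd (tV D m 0) (n + q - h)| := abs_sub _ _
      _ ≤ Λ * Y ^ 3 + Λ * Y ^ 3 := add_le_add (B _ k1).1 (B _ k2).1
      _ ≤ 4 * Λ * Y ^ 3 := by linarith
  · rw [e2]
    calc _ ≤ |fd (tV D m 0) (n + q + h)| + |fd (tV D m 0) (n + q - h - 1)| +
          |fd (tV D m 0) (n + h + r)| + |fd (tV D m 0) (n - h - r - 1)| := by
            refine (abs_sub _ _).trans (add_le_add ((abs_sub _ _).trans (add_le_add (abs_add_le _ _) le_rfl)) le_rfl)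
      _ ≤ Λ * Y ^ 3 + Λ * Y ^ 3 + Λ * Y ^ 3 + Λ * Y ^ 3 :=
          add_le_add (add_le_add (add_le_add (B _ k1).1 (B _ k2').1) (B _ k3).1) (B _ k4').1
      _ = 4 * Λ * Y ^ 3 := by ring
  · rw [e3]
    calc _ ≤ |fd (tV D m 0) (n + q + h)| + |fd (tV D m 0) (n + q - h)| +
          |fd (tV D m 0) (n + h + r)| + |fd (tV D m 0) (n - h - r)| := by
            refine (abs_add_le _ _).trans (add_le_add ((abs_sub _ _).trans (add_le_add (abs_sub _ _) le_rfl)) le_rfl)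
      _ ≤ Λ * Y ^ 3 + Λ * Y ^ 3 + Λ * Y ^ 3 + Λ * Y ^ 3 :=
          add_le_add (add_le_add (add_le_add (B _ k1).1 (B _ k2).1) (B _ k3).1) (B _ k4).1
      _ = 4 * Λ * Y ^ 3 := by ring
  · rw [e12]
    calc _ ≤ |fd (fd (tV D m 0)) (n + q + h)| + |fd (fd (tV D m 0)) (n + q - h - 1)| := abs_add_le _ _
      _ ≤ Λ * Y ^ 2 + Λ * Y ^ 2 := add_le_add (B _ k1).2.1 (B _ k2').2.1
      _ ≤ 4 * Λ * Y ^ 2 := by linarith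
  · rw [e13]
    calc _ ≤ |fd (fd (tV D m 0)) (n + q + h)| + |fd (fd (tV D m 0)) (n + q - h)| := abs_sub _ _
      _ ≤ Λ * Y ^ 2 + Λ * Y ^ 2 := add_le_add (B _ k1).2.1 (B _ k2).2.1
      _ ≤ 4 * Λ * Y ^ 2 := by linarith
  · rw [e23]
    calc _ ≤ |fd (fd (tV D m 0)) (n + q + h)| + |fd (fd (tV D m 0)) (n + q - h - 1)| +
          |fd (fd (tV D m 0)) (n + h + r)| + |fd (fd (tV D m 0)) (n - h - r - 1)| := by
            refine (abs_sub _ _).trans (add_le_add ((abs_sub _ _).trans (add_le_add (abs_add_le _ _) le_rfl)) le_rfl)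
      _ ≤ Λ * Y ^ 2 + Λ * Y ^ 2 + Λ * Y ^ 2 + Λ * Y ^ 2 :=
          add_le_add (add_le_add (add_le_add (B _ k1).2.1 (B _ k2').2.1) (B _ k3).2.1) (B _ k4').2.1
      _ = 4 * Λ * Y ^ 2 := by ring
  · rw [e123]
    calc _ ≤ |fd (fd (fd (tV D m 0))) (n + q + h)| + |fd (fd (fd (tV D m 0))) (n + q - h - 1)| := abs_add_le _ _
      _ ≤ Λ * Y + Λ * Y := add_le_add (B _ k1).2.2 (B _ k2').2.2
      _ = 2 * Λ * Y := by ring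

/-! ### Increments of `f'''` and of `2f''` (Steps 5 and 6) -/

/-- `|f'''(y) - f'''(x)| ≤ Λ|y - x|` on `[a, b]` when `|D 4| ≤ Λ`. [folklore] -/
theorem abs_D3_sub_le {D : ℕ → ℝ → ℝ} {a b Λ : ℝ} (hD : DerivFamily D a b 4)
    (hΛ : ∀ t ∈ Icc a b, |D 4 t| ≤ Λ) {x y : ℝ} (hx : x ∈ Icc a b) (hy : y ∈ Icc a b) :
    |D 3 y - D 3 x| ≤ Λ * |y - x| := by
  have h3 := fun t (ht : t ∈ Icc a b) => hD 3 (by norm_num) t ht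
  rcases le_total x y with hxy | hxy
  · have hsub : Icc x y ⊆ Icc a b := Icc_subset_Icc hx.1 hy.2
    rw [abs_of_nonneg (by linarith : (0:ℝ) ≤ y - x)]
    exact abs_sub_le_of_hasDerivAt hxy (fun t ht => h3 t (hsub ht)) fun t ht => hΛ t (hsub ht)
  · have hsub : Icc y x ⊆ Icc a b := Icc_subset_Icc hy.1 hx.2
    rw [abs_sub_comm, abs_of_nonpos (by linarith : y - x ≤ 0)]
    have := abs_sub_le_of_hasDerivAt hxy (fun t ht => h3 t (hsub ht)) fun t ht => hΛ t (hsub ht)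
    convert this using 1; ring

/-- `λ(y - x) ≤ f'''(y) - f'''(x) ≤ Λ(y - x)` for `x ≤ y` in `[a, b]` when `λ ≤ D 4 ≤ Λ`. [folklore] -/
theorem D3_incr {D : ℕ → ℝ → ℝ} {a b lam Λ : ℝ} (hD : DerivFamily D a b 4)
    (hb : ∀ t ∈ Icc a b, lam ≤ D 4 t ∧ D 4 t ≤ Λ) {x y : ℝ} (hx : a ≤ x) (hxy : x ≤ y) (hy : y ≤ b) :
    lam * (y - x) ≤ D 3 y - D 3 x ∧ D 3 y - D 3 x ≤ Λ * (y - x) := by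
  have hsub : Icc x y ⊆ Icc a b := Icc_subset_Icc hx hy
  exact sub_mem_of_hasDerivAt hxy (fun t ht => hD 3 (by norm_num) t (hsub ht)) fun t ht => hb t (hsub ht)

/-- For integers... rather reals `k ≥ 0`: `2kλ(y - x) ≤ (2f''(y+k) - 2f''(y)) - (2f''(x+k) - 2f''(x)) ≤ 2kΛ(y - x)`
for `a ≤ x ≤ y`, `y + k ≤ b`, when `λ ≤ D 4 ≤ Λ` (two mean value theorems). [folklore] -/
theorem twoD2_incr {D : ℕ → ℝ → ℝ} {a b lam Λ : ℝ} (hD : DerivFamily D a b 4)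
    (hb : ∀ t ∈ Icc a b, lam ≤ D 4 t ∧ D 4 t ≤ Λ) {k x y : ℝ} (hk : 0 ≤ k) (hx : a ≤ x) (hxy : x ≤ y)
    (hy : y + k ≤ b) :
    2 * k * lam * (y - x) ≤ (2 * D 2 (y + k) - 2 * D 2 y) - (2 * D 2 (x + k) - 2 * D 2 x) ∧
      (2 * D 2 (y + k) - 2 * D 2 y) - (2 * D 2 (x + k) - 2 * D 2 x) ≤ 2 * k * Λ * (y - x) := by
  -- `w(t) = D 2 (t + k) - D 2 t`, `w' = D 3 (t+k) - D 3 t ∈ [kλ, kΛ]`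
  have hw : ∀ t ∈ Icc x y, HasDerivAt (fun t => D 2 (t + k) - D 2 t) (D 3 (t + k) - D 3 t) t := by
    intro t ht
    have h1 := hD 2 (by norm_num) (t + k) ⟨by linarith [ht.1], by linarith [ht.2]⟩
    have h2 := hD 2 (by norm_num) t ⟨by linarith [ht.1], by linarith [ht.2]⟩
    exact (HasDerivAt.comp_add_const t k h1).sub h2
  have hw' : ∀ t ∈ Icc x y, k * lam ≤ D 3 (t + k) - D 3 t ∧ D 3 (t + k) - D 3 t ≤ k * Λ := by
    intro t ht
    have := D3_incr hD hb (x := t) (y := t + k) (by linarith [ht.1]) (by linarith) (by linarith [ht.2])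
    constructor <;> nlinarith [this.1, this.2]
  have := sub_mem_of_hasDerivAt hxy hw hw'
  constructor <;> nlinarith [this.1, this.2]

end RobertSargos
end Literature.NumberTheory.LFunctions

end
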